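import Summits.QuantumFields.YangMills.Theorems.ColdStartUniversalityShenZhuZhuTalagrandSU2
import Summits.QuantumFields.YangMills.Theorems.ColdStartUniversalityShenZhuZhuRiemannDistTriangleSU2
import Literature.MathematicalPhysics.QuantumLattice.LatticeGaugeDLR
import HarnessLib

/-!
# TALAGRAND'S `T₂` IN BOBKOV–GÖTZE DUAL FORM FOR EVERY INFINITE-VOLUME LIMIT POINT of three-dimensional `SU(2)` lattice Yang–Mills at `|β'| < 1/12`,
# window by window:  `∫ exp(Q_B φ) dμ ≤ exp(∫ φ dμ)`,  `Q_B φ(x) = inf_y [φ(y) + ρ_B(x,y)²/(2C)]`,  `C = 1/(1 − 12|β'|)`, for every finite `B ⊆ E⁺(ℤ³)`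

Seat `ym-line-csu-p1` (g43), route `ColdStartUniversality` of `Summits/QuantumFields/YangMills`, helper file (`--supports stmt-QuantumFields-24809`;
memo-g42 §3 item 3).  g42 proved the dual transport inequality `∫ e^(Q_C f) dμ_(β',L) ≤ e^(∫ f dμ_(β',L))` on every torus (`wilson_integral_exp_hopfLax_le`, cost
`ρ_L²`, `C = 1/(1−12|β'|)` uniform in `L`).  Here it is passed to the infinite volume.  For a finite edge window `B` of `ℤ³` let `ρ_B(x,y)² = Σ_(ẽ ∈ B) ρ(x_ẽ,y_ẽ)²`
(a continuous pseudometric on `SU(2)^(E⁺(ℤ³))`).  For `L` large the periodisation `torusEdge L` is injective on `B`, so `ρ_B(torusLift U, torusLift U') ≤ ρ_L(U,U')`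
and `(Q_B φ)∘torusLift ≤ Q^(ρ_L)(φ∘torusLift)`; the torus inequality and the convergence of the torus states on bounded continuous cylinder functions
(`exp ∘ Q_B φ` is one) give the dual `T₂(C)` inequality for EVERY limit point and EVERY window, with the torus constant.
* `windowDistSq_torusLift_le`, `eventually_injOn_torusEdge` — periodisation is injective on a window for large `L`;
* `continuous_of_windowLipschitz`, `abs_windowDistSq_sub_le`, `hopfLaxWindow_le_self`, `neg_le_hopfLaxWindow`, `hopfLaxWindow_sub_le`, `continuous_hopfLaxWindow`,
  `isCylinder_hopfLaxWindow` — the window Hopf–Lax function is a bounded continuous cylinder function;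
* ★★ `torus_integral_exp_hopfLaxWindow_le` — the torus inequality with the window cost;
* ★★★★ **`limitPoint_integral_exp_hopfLaxWindow_le`** — for `μ ∈ infiniteVolumeLimitPoints (fundamentalRep (Fin 2)) β'`, `|β'| < 1/12`, every finite `B` and every
  `ρ_B`-Lipschitz `φ`:  `∫ exp(⨅_y [φ y + ρ_B(·,y)²/(2C)]) dμ ≤ exp(∫ φ dμ)` — Talagrand's `T₂(C)` for `μ` in Bobkov–Götze dual form, window by window, `C = 1/(1−12|β'|)`.
THEOREMS ONLY, no definition, no sorry.  HONEST FRAMING: a statement about infinite-volume limit points of the FIXED-lattice theory at strong coupling / high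
temperature `|β'| < 1/12`; the constant does not depend on the window, but this file does not assemble the `ρ_∞` (extended-metric) coupling form; nothing about
the continuum or the mass gap; no crux, rung or summit statement is proved; the Yang–Mills mass gap is NOT proved.
-/

set_option autoImplicit false

noncomputable section

namespace Summit.QuantumFields.YangMills.Theorems.ColdStartUniversality

open MeasureTheory Filter Topology Set Metric Finset
open scoped BigOperators NNReal ENNReal
open Literature.MathematicalPhysics.QuantumFieldTheory
open Literature.MathematicalPhysics.QuantumLattice (fundamentalRep fundamentalLatticeRep continuous_fundamentalRep fundamentalRep_apply fundamentalLatticeRep_N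
  IsCylinder infiniteVolumeLimitPoints IsInfiniteVolumeLimitAlong toTorusObservable)

/-! ## §1. The window pseudometric and the periodisation -/

/-- `ρ_B(torusLift U, torusLift U')² ≤ ρ_L(U,U')²` when `torusEdge L` is injective on the window `B`. [folklore] -/
theorem windowDistSq_torusLift_le {L : ℕ} [NeZero L] (B : Finset (Literature.MathematicalPhysics.QuantumLattice.ZdEdge 3)) (hinj : Set.InjOn (Literature.MathematicalPhysics.QuantumLattice.torusEdge (d := 3) L) ↑B)
    (U U' : GaugeConfig 3 L (Matrix.specialUnitaryGroup (Fin 2) ℂ)) :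
    (∑ et ∈ B, (fundamentalLatticeRep 2).riemannDist (Literature.MathematicalPhysics.QuantumLattice.torusLift L U et) (Literature.MathematicalPhysics.QuantumLattice.torusLift L U' et) ^ 2) ≤ torusRiemannDistSq (fundamentalLatticeRep 2) U U' := by
  classical
  have h1 : ∑ e ∈ B.image (Literature.MathematicalPhysics.QuantumLattice.torusEdge (d := 3) L), (fundamentalLatticeRep 2).riemannDist (U e) (U' e) ^ 2 =
      ∑ et ∈ B, (fundamentalLatticeRep 2).riemannDist (U (Literature.MathematicalPhysics.QuantumLattice.torusEdge (d := 3) L et)) (U' (Literature.MathematicalPhysics.QuantumLattice.torusEdge (d := 3) L et)) ^ 2 :=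
    Finset.sum_image fun x hx y hy h => hinj hx hy h
  have h2 : (∑ et ∈ B, (fundamentalLatticeRep 2).riemannDist (Literature.MathematicalPhysics.QuantumLattice.torusLift L U et) (Literature.MathematicalPhysics.QuantumLattice.torusLift L U' et) ^ 2) = ∑ et ∈ B, (fundamentalLatticeRep 2).riemannDist (U (Literature.MathematicalPhysics.QuantumLattice.torusEdge (d := 3) L et)) (U' (Literature.MathematicalPhysics.QuantumLattice.torusEdge (d := 3) L et)) ^ 2 := rfl
  rw [h2, ← h1]
  unfold torusRiemannDistSq
  exact Finset.sum_le_univ_sum_of_nonneg fun e => sq_nonneg _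

/-- For every finite window `B ⊆ E⁺(ℤ³)` the periodisation `torusEdge L` is injective on `B` for all large `L`. [folklore] -/
theorem eventually_injOn_torusEdge (B : Finset (Literature.MathematicalPhysics.QuantumLattice.ZdEdge 3)) :
    ∀ᶠ L : ℕ in atTop, Set.InjOn (Literature.MathematicalPhysics.QuantumLattice.torusEdge (d := 3) L) ↑B := by
  classical
  obtain ⟨g, hg⟩ : ∃ g : (Literature.MathematicalPhysics.QuantumLattice.ZdEdge 3) → (Literature.MathematicalPhysics.QuantumLattice.ZdEdge 3) → ℕ, g = fun e e' => Finset.univ.sup fun m : Fin 3 => (e.1 m - e'.1 m).natAbs := ⟨_, rfl⟩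
  obtain ⟨M, hMdef⟩ : ∃ M : ℕ, M = B.sup fun e => B.sup fun e' => g e e' := ⟨_, rfl⟩
  have hle : ∀ e ∈ B, ∀ e' ∈ B, ∀ m : Fin 3, (e.1 m - e'.1 m).natAbs ≤ M := by
    intro e he e' he' m
    have h1 : (e.1 m - e'.1 m).natAbs ≤ g e e' := by
      rw [hg]; exact Finset.le_sup (f := fun m : Fin 3 => (e.1 m - e'.1 m).natAbs) (Finset.mem_univ m)
    have h2 : g e e' ≤ B.sup fun e' => g e e' := Finset.le_sup (f := fun e' => g e e') he'
    have h3 : (B.sup fun e' => g e e') ≤ M := by rw [hMdef]; exact Finset.le_sup (f := fun e => B.sup fun e' => g e e') he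
    exact h1.trans (h2.trans h3)
  refine Filter.eventually_atTop.2 ⟨M + 1, fun L hL e he e' he' h => ?_⟩
  have h2 : e.2 = e'.2 := by
    simpa [Literature.MathematicalPhysics.QuantumLattice.torusEdge] using congrArg Prod.snd h
  have h1 : Literature.Probability.LatticeModels.Torus.proj L e.1 = Literature.Probability.LatticeModels.Torus.proj L e'.1 := by
    simpa [Literature.MathematicalPhysics.QuantumLattice.torusEdge] using congrArg Prod.fst h
  refine Prod.ext (funext fun m => ?_) h2
  have hm : ((e.1 m : ℤ) : ZMod L) = ((e'.1 m : ℤ) : ZMod L) := by simpa using congrFun h1 m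
  have hdvd : (L : ℤ) ∣ e'.1 m - e.1 m := (ZMod.intCast_eq_intCast_iff_dvd_sub (e.1 m) (e'.1 m) L).1 hm
  have hlt : (e'.1 m - e.1 m).natAbs < ((L : ℤ)).natAbs := by
    rw [Int.natAbs_natCast]
    have := hle e' he' e he m
    omega
  have h0 := Int.eq_zero_of_dvd_of_natAbs_lt_natAbs hdvd hlt
  omega

/-! ## §2. The window Hopf–Lax function is a bounded continuous cylinder function -/

/-- A `ρ_B`-Lipschitz function on `SU(2)^(E⁺(ℤ³))` is continuous. [folklore] -/
theorem continuous_of_windowLipschitz (B : Finset (Literature.MathematicalPhysics.QuantumLattice.ZdEdge 3)) {φ : Literature.MathematicalPhysics.QuantumLattice.LGConfig 3 (Matrix.specialUnitaryGroup (Fin 2) ℂ) → ℝ} {Lf : ℝ}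
    (hlip : ∀ x y, |φ y - φ x| ≤ Lf * Real.sqrt (∑ et ∈ B, (fundamentalLatticeRep 2).riemannDist (x et) (y et) ^ 2)) : Continuous φ := by
  refine continuous_iff_continuousAt.2 fun x => ?_
  rw [ContinuousAt, tendsto_iff_norm_sub_tendsto_zero]
  have hc : Continuous fun y : Literature.MathematicalPhysics.QuantumLattice.LGConfig 3 (Matrix.specialUnitaryGroup (Fin 2) ℂ) => Lf * Real.sqrt (∑ et ∈ B, (fundamentalLatticeRep 2).riemannDist (x et) (y et) ^ 2) :=
    continuous_const.mul (Real.continuous_sqrt.comp (continuous_finsetSum _ fun et _ =>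
      ((continuous_riemannDist_two_right (x et)).comp (continuous_apply et)).pow 2))
  have h0 : Tendsto (fun y : Literature.MathematicalPhysics.QuantumLattice.LGConfig 3 (Matrix.specialUnitaryGroup (Fin 2) ℂ) => Lf * Real.sqrt (∑ et ∈ B, (fundamentalLatticeRep 2).riemannDist (x et) (y et) ^ 2)) (𝓝 x) (𝓝 0) := by
    have h := hc.tendsto x
    have hz : (∑ et ∈ B, (fundamentalLatticeRep 2).riemannDist (x et) (x et) ^ 2) = 0 := Finset.sum_eq_zero fun et _ => by rw [(fundamentalLatticeRep 2).riemannDist_self, sq, mul_zero]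
    rwa [hz, Real.sqrt_zero, mul_zero] at h
  exact squeeze_zero (fun _ => norm_nonneg _) (fun y => by rw [Real.norm_eq_abs]; exact hlip x y) h0

/-- A `ρ_B`-Lipschitz function is a cylinder function on the window `B`. [folklore] -/
theorem isCylinder_of_windowLipschitz (B : Finset (Literature.MathematicalPhysics.QuantumLattice.ZdEdge 3)) {φ : Literature.MathematicalPhysics.QuantumLattice.LGConfig 3 (Matrix.specialUnitaryGroup (Fin 2) ℂ) → ℝ} {Lf : ℝ}
    (hlip : ∀ x y, |φ y - φ x| ≤ Lf * Real.sqrt (∑ et ∈ B, (fundamentalLatticeRep 2).riemannDist (x et) (y et) ^ 2)) : IsCylinder φ B := by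
  intro x y hxy
  have hz : (∑ et ∈ B, (fundamentalLatticeRep 2).riemannDist (x et) (y et) ^ 2) = 0 :=
    Finset.sum_eq_zero fun et het => by rw [hxy et (Finset.mem_coe.1 het), (fundamentalLatticeRep 2).riemannDist_self, sq, mul_zero]
  have h := hlip x y
  rw [hz, Real.sqrt_zero, mul_zero] at h
  have := abs_nonpos_iff.1 h
  linarith [this]

/-- `|ρ_B(x,y)² − ρ_B(x',y)²| ≤ 2√2π·Σ_(ẽ∈B) ρ(x_ẽ, x'_ẽ)` (each link of `SU(2)` has diameter `√2·π`). [folklore] -/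
theorem abs_windowDistSq_sub_le (B : Finset (Literature.MathematicalPhysics.QuantumLattice.ZdEdge 3)) (x x' y : Literature.MathematicalPhysics.QuantumLattice.LGConfig 3 (Matrix.specialUnitaryGroup (Fin 2) ℂ)) :
    |(∑ et ∈ B, (fundamentalLatticeRep 2).riemannDist (x et) (y et) ^ 2) - (∑ et ∈ B, (fundamentalLatticeRep 2).riemannDist (x' et) (y et) ^ 2)| ≤ (2 * Real.sqrt 2 * Real.pi) * ∑ et ∈ B, (fundamentalLatticeRep 2).riemannDist (x et) (x' et) := by
  rw [← Finset.sum_sub_distrib, Finset.mul_sum]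
  refine (Finset.abs_sum_le_sum_abs _ _).trans (Finset.sum_le_sum fun et _ => ?_)
  have ha := (fundamentalLatticeRep 2).riemannDist_nonneg (x et) (y et)
  have hb := (fundamentalLatticeRep 2).riemannDist_nonneg (x' et) (y et)
  have hc := (fundamentalLatticeRep 2).riemannDist_nonneg (x et) (x' et)
  have hA := riemannDist_two_le (x et) (y et)
  have hB := riemannDist_two_le (x' et) (y et)
  have h1 : (fundamentalLatticeRep 2).riemannDist (x et) (y et) ≤ (fundamentalLatticeRep 2).riemannDist (x et) (x' et) + (fundamentalLatticeRep 2).riemannDist (x' et) (y et) := riemannDist_two_triangle _ _ _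
  have h2 : (fundamentalLatticeRep 2).riemannDist (x' et) (y et) ≤ (fundamentalLatticeRep 2).riemannDist (x' et) (x et) + (fundamentalLatticeRep 2).riemannDist (x et) (y et) := riemannDist_two_triangle _ _ _
  rw [riemannDist_two_comm (x' et) (x et)] at h2
  rw [sq_sub_sq, abs_mul]
  have h3 : |(fundamentalLatticeRep 2).riemannDist (x et) (y et) - (fundamentalLatticeRep 2).riemannDist (x' et) (y et)| ≤ (fundamentalLatticeRep 2).riemannDist (x et) (x' et) := abs_sub_le_iff.2 ⟨by linarith, by linarith⟩
  have h4 : |(fundamentalLatticeRep 2).riemannDist (x et) (y et) + (fundamentalLatticeRep 2).riemannDist (x' et) (y et)| ≤ (2 * Real.sqrt 2 * Real.pi) := by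
    rw [abs_of_nonneg (by positivity)]; linarith
  exact mul_le_mul h4 h3 (abs_nonneg _) (by positivity)

/-- The window Hopf–Lax family is bounded below (by a lower bound of `φ`). [folklore] -/
theorem bddBelow_hopfLaxWindow (B : Finset (Literature.MathematicalPhysics.QuantumLattice.ZdEdge 3)) {φ : Literature.MathematicalPhysics.QuantumLattice.LGConfig 3 (Matrix.specialUnitaryGroup (Fin 2) ℂ) → ℝ} {C₀ : ℝ} (hφ : ∀ y, -C₀ ≤ φ y) {β' : ℝ} (hβ : |β'| < 1 / 12) (x : Literature.MathematicalPhysics.QuantumLattice.LGConfig 3 (Matrix.specialUnitaryGroup (Fin 2) ℂ)) :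
    BddBelow (Set.range fun y : Literature.MathematicalPhysics.QuantumLattice.LGConfig 3 (Matrix.specialUnitaryGroup (Fin 2) ℂ) => φ y + (∑ et ∈ B, (fundamentalLatticeRep 2).riemannDist (x et) (y et) ^ 2) / (2 * (1 / (1 - 12 * |β'|)))) := by
  refine ⟨-C₀, ?_⟩
  rintro _ ⟨y, rfl⟩
  have h12 : 0 < 1 - 12 * |β'| := by linarith
  have hC : 0 < 2 * (1 / (1 - 12 * |β'|)) := by positivity
  have h0 : 0 ≤ (∑ et ∈ B, (fundamentalLatticeRep 2).riemannDist (x et) (y et) ^ 2) / (2 * (1 / (1 - 12 * |β'|))) := div_nonneg (Finset.sum_nonneg fun _ _ => sq_nonneg _) hC.le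
  show -C₀ ≤ φ y + (∑ et ∈ B, (fundamentalLatticeRep 2).riemannDist (x et) (y et) ^ 2) / (2 * (1 / (1 - 12 * |β'|)))
  linarith [hφ y]

/-- `Q_B φ ≤ φ`. [folklore] -/
theorem hopfLaxWindow_le_self (B : Finset (Literature.MathematicalPhysics.QuantumLattice.ZdEdge 3)) {φ : Literature.MathematicalPhysics.QuantumLattice.LGConfig 3 (Matrix.specialUnitaryGroup (Fin 2) ℂ) → ℝ} {C₀ : ℝ} (hφ : ∀ y, -C₀ ≤ φ y) {β' : ℝ} (hβ : |β'| < 1 / 12) (x : Literature.MathematicalPhysics.QuantumLattice.LGConfig 3 (Matrix.specialUnitaryGroup (Fin 2) ℂ)) :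
    (⨅ y : Literature.MathematicalPhysics.QuantumLattice.LGConfig 3 (Matrix.specialUnitaryGroup (Fin 2) ℂ), (φ y + (∑ et ∈ B, (fundamentalLatticeRep 2).riemannDist (x et) (y et) ^ 2) / (2 * (1 / (1 - 12 * |β'|))))) ≤ φ x := by
  refine (ciInf_le (bddBelow_hopfLaxWindow B hφ hβ x) x).trans (le_of_eq ?_)
  have hz : (∑ et ∈ B, (fundamentalLatticeRep 2).riemannDist (x et) (x et) ^ 2) = 0 := Finset.sum_eq_zero fun et _ => by rw [(fundamentalLatticeRep 2).riemannDist_self, sq, mul_zero]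
  rw [hz, zero_div, add_zero]

/-- `−C₀ ≤ Q_B φ` when `−C₀ ≤ φ`. [folklore] -/
theorem neg_le_hopfLaxWindow (B : Finset (Literature.MathematicalPhysics.QuantumLattice.ZdEdge 3)) {φ : Literature.MathematicalPhysics.QuantumLattice.LGConfig 3 (Matrix.specialUnitaryGroup (Fin 2) ℂ) → ℝ} {C₀ : ℝ} (hφ : ∀ y, -C₀ ≤ φ y) {β' : ℝ} (hβ : |β'| < 1 / 12) (x : Literature.MathematicalPhysics.QuantumLattice.LGConfig 3 (Matrix.specialUnitaryGroup (Fin 2) ℂ)) :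
    -C₀ ≤ (⨅ y : Literature.MathematicalPhysics.QuantumLattice.LGConfig 3 (Matrix.specialUnitaryGroup (Fin 2) ℂ), (φ y + (∑ et ∈ B, (fundamentalLatticeRep 2).riemannDist (x et) (y et) ^ 2) / (2 * (1 / (1 - 12 * |β'|))))) := by
  refine le_ciInf fun y => ?_
  have h12 : 0 < 1 - 12 * |β'| := by linarith
  have hC : 0 < 2 * (1 / (1 - 12 * |β'|)) := by positivity
  have h0 : 0 ≤ (∑ et ∈ B, (fundamentalLatticeRep 2).riemannDist (x et) (y et) ^ 2) / (2 * (1 / (1 - 12 * |β'|))) := div_nonneg (Finset.sum_nonneg fun _ _ => sq_nonneg _) hC.le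
  linarith [hφ y]

/-- The window Hopf–Lax function moves by at most `(2√2π/(2C))·Σ_(ẽ∈B) ρ(x_ẽ,x'_ẽ)`. [folklore] -/
theorem hopfLaxWindow_sub_le (B : Finset (Literature.MathematicalPhysics.QuantumLattice.ZdEdge 3)) {φ : Literature.MathematicalPhysics.QuantumLattice.LGConfig 3 (Matrix.specialUnitaryGroup (Fin 2) ℂ) → ℝ} {C₀ : ℝ} (hφ : ∀ y, -C₀ ≤ φ y) {β' : ℝ} (hβ : |β'| < 1 / 12) (x x' : Literature.MathematicalPhysics.QuantumLattice.LGConfig 3 (Matrix.specialUnitaryGroup (Fin 2) ℂ)) :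
    (⨅ y : Literature.MathematicalPhysics.QuantumLattice.LGConfig 3 (Matrix.specialUnitaryGroup (Fin 2) ℂ), (φ y + (∑ et ∈ B, (fundamentalLatticeRep 2).riemannDist (x et) (y et) ^ 2) / (2 * (1 / (1 - 12 * |β'|))))) - (⨅ y : Literature.MathematicalPhysics.QuantumLattice.LGConfig 3 (Matrix.specialUnitaryGroup (Fin 2) ℂ), (φ y + (∑ et ∈ B, (fundamentalLatticeRep 2).riemannDist (x' et) (y et) ^ 2) / (2 * (1 / (1 - 12 * |β'|))))) ≤ (2 * Real.sqrt 2 * Real.pi) / (2 * (1 / (1 - 12 * |β'|))) * ∑ et ∈ B, (fundamentalLatticeRep 2).riemannDist (x et) (x' et) := by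
  have h12 : 0 < 1 - 12 * |β'| := by linarith
  have hC : 0 < 2 * (1 / (1 - 12 * |β'|)) := by positivity
  obtain ⟨δ, hδ⟩ : ∃ δ : ℝ, δ = (2 * Real.sqrt 2 * Real.pi) / (2 * (1 / (1 - 12 * |β'|))) * ∑ et ∈ B, (fundamentalLatticeRep 2).riemannDist (x et) (x' et) := ⟨_, rfl⟩
  rw [← hδ, sub_le_iff_le_add']
  have hkey : ∀ y : Literature.MathematicalPhysics.QuantumLattice.LGConfig 3 (Matrix.specialUnitaryGroup (Fin 2) ℂ), (⨅ y : Literature.MathematicalPhysics.QuantumLattice.LGConfig 3 (Matrix.specialUnitaryGroup (Fin 2) ℂ), (φ y + (∑ et ∈ B, (fundamentalLatticeRep 2).riemannDist (x et) (y et) ^ 2) / (2 * (1 / (1 - 12 * |β'|))))) ≤ (φ y + (∑ et ∈ B, (fundamentalLatticeRep 2).riemannDist (x' et) (y et) ^ 2) / (2 * (1 / (1 - 12 * |β'|)))) + δ := by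
    intro y
    refine (ciInf_le (bddBelow_hopfLaxWindow B hφ hβ x) y).trans ?_
    have h1 := abs_windowDistSq_sub_le B x x' y
    have h2 : (∑ et ∈ B, (fundamentalLatticeRep 2).riemannDist (x et) (y et) ^ 2) ≤ (∑ et ∈ B, (fundamentalLatticeRep 2).riemannDist (x' et) (y et) ^ 2) + (2 * Real.sqrt 2 * Real.pi) * ∑ et ∈ B, (fundamentalLatticeRep 2).riemannDist (x et) (x' et) := by
      have := (abs_sub_le_iff.1 h1).1; linarith
    have h3 : (∑ et ∈ B, (fundamentalLatticeRep 2).riemannDist (x et) (y et) ^ 2) / (2 * (1 / (1 - 12 * |β'|))) ≤ (∑ et ∈ B, (fundamentalLatticeRep 2).riemannDist (x' et) (y et) ^ 2) / (2 * (1 / (1 - 12 * |β'|))) + δ := by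
      rw [hδ, div_mul_eq_mul_div, ← add_div]
      exact div_le_div_of_nonneg_right h2 hC.le
    show φ y + (∑ et ∈ B, (fundamentalLatticeRep 2).riemannDist (x et) (y et) ^ 2) / (2 * (1 / (1 - 12 * |β'|))) ≤ _
    linarith
  rw [ciInf_add (bddBelow_hopfLaxWindow B hφ hβ x') δ]
  exact le_ciInf hkey

/-- ★ **The window Hopf–Lax function is continuous** (for the product topology of `SU(2)^(E⁺(ℤ³))`). [folklore] -/
theorem continuous_hopfLaxWindow (B : Finset (Literature.MathematicalPhysics.QuantumLattice.ZdEdge 3)) {φ : Literature.MathematicalPhysics.QuantumLattice.LGConfig 3 (Matrix.specialUnitaryGroup (Fin 2) ℂ) → ℝ} {C₀ : ℝ} (hφ : ∀ y, -C₀ ≤ φ y) {β' : ℝ} (hβ : |β'| < 1 / 12) :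
    Continuous fun x : Literature.MathematicalPhysics.QuantumLattice.LGConfig 3 (Matrix.specialUnitaryGroup (Fin 2) ℂ) => (⨅ y : Literature.MathematicalPhysics.QuantumLattice.LGConfig 3 (Matrix.specialUnitaryGroup (Fin 2) ℂ), (φ y + (∑ et ∈ B, (fundamentalLatticeRep 2).riemannDist (x et) (y et) ^ 2) / (2 * (1 / (1 - 12 * |β'|))))) := by
  refine continuous_iff_continuousAt.2 fun x => ?_
  rw [ContinuousAt, tendsto_iff_norm_sub_tendsto_zero]
  have hc : Continuous fun x' : Literature.MathematicalPhysics.QuantumLattice.LGConfig 3 (Matrix.specialUnitaryGroup (Fin 2) ℂ) => (2 * Real.sqrt 2 * Real.pi) / (2 * (1 / (1 - 12 * |β'|))) * ∑ et ∈ B, (fundamentalLatticeRep 2).riemannDist (x et) (x' et) :=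
    continuous_const.mul (continuous_finsetSum _ fun et _ => (continuous_riemannDist_two_right (x et)).comp (continuous_apply et))
  have h0 : Tendsto (fun x' : Literature.MathematicalPhysics.QuantumLattice.LGConfig 3 (Matrix.specialUnitaryGroup (Fin 2) ℂ) => (2 * Real.sqrt 2 * Real.pi) / (2 * (1 / (1 - 12 * |β'|))) * ∑ et ∈ B, (fundamentalLatticeRep 2).riemannDist (x et) (x' et)) (𝓝 x) (𝓝 0) := by
    have h := hc.tendsto x
    have hz : ∑ et ∈ B, (fundamentalLatticeRep 2).riemannDist (x et) (x et) = 0 := Finset.sum_eq_zero fun et _ => (fundamentalLatticeRep 2).riemannDist_self _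
    rwa [hz, mul_zero] at h
  refine squeeze_zero (fun _ => norm_nonneg _) (fun x' => ?_) h0
  rw [Real.norm_eq_abs, abs_sub_le_iff]
  constructor
  · have h := hopfLaxWindow_sub_le B hφ hβ x' x
    have hs : ∑ et ∈ B, (fundamentalLatticeRep 2).riemannDist (x' et) (x et) = ∑ et ∈ B, (fundamentalLatticeRep 2).riemannDist (x et) (x' et) := Finset.sum_congr rfl fun et _ => riemannDist_two_comm _ _
    rw [hs] at h; exact h
  · exact hopfLaxWindow_sub_le B hφ hβ x x'

/-- The window Hopf–Lax function is a cylinder function on `B`. [folklore] -/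
theorem isCylinder_hopfLaxWindow (B : Finset (Literature.MathematicalPhysics.QuantumLattice.ZdEdge 3)) (φ : Literature.MathematicalPhysics.QuantumLattice.LGConfig 3 (Matrix.specialUnitaryGroup (Fin 2) ℂ) → ℝ) (β' : ℝ) : IsCylinder (fun x : Literature.MathematicalPhysics.QuantumLattice.LGConfig 3 (Matrix.specialUnitaryGroup (Fin 2) ℂ) => (⨅ y : Literature.MathematicalPhysics.QuantumLattice.LGConfig 3 (Matrix.specialUnitaryGroup (Fin 2) ℂ), (φ y + (∑ et ∈ B, (fundamentalLatticeRep 2).riemannDist (x et) (y et) ^ 2) / (2 * (1 / (1 - 12 * |β'|)))))) B := by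
  intro x x' hxx'
  have h : ∀ y : Literature.MathematicalPhysics.QuantumLattice.LGConfig 3 (Matrix.specialUnitaryGroup (Fin 2) ℂ), (∑ et ∈ B, (fundamentalLatticeRep 2).riemannDist (x et) (y et) ^ 2) = (∑ et ∈ B, (fundamentalLatticeRep 2).riemannDist (x' et) (y et) ^ 2) := fun y =>
    Finset.sum_congr rfl fun et het => by rw [hxx' et (Finset.mem_coe.1 het)]
  show (⨅ y : Literature.MathematicalPhysics.QuantumLattice.LGConfig 3 (Matrix.specialUnitaryGroup (Fin 2) ℂ), (φ y + (∑ et ∈ B, (fundamentalLatticeRep 2).riemannDist (x et) (y et) ^ 2) / (2 * (1 / (1 - 12 * |β'|))))) = (⨅ y : Literature.MathematicalPhysics.QuantumLattice.LGConfig 3 (Matrix.specialUnitaryGroup (Fin 2) ℂ), (φ y + (∑ et ∈ B, (fundamentalLatticeRep 2).riemannDist (x' et) (y et) ^ 2) / (2 * (1 / (1 - 12 * |β'|)))))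
  simp_rw [h]

/-! ## §3. The torus inequality with the window cost -/

/-- ★★ **Dual `T₂` on the torus with the window cost.**  If `torusEdge L` is injective on `B`, `|β'| < 1/12`, and `φ` is `ρ_B`-Lipschitz and bounded below, then
`∫ exp((Q_B φ)(torusLift U)) dμ_(β',L)(U) ≤ exp(∫ φ∘torusLift dμ_(β',L))` (`(Q_Bφ)∘torusLift ≤ Q^(ρ_L)(φ∘torusLift)` and g42's torus inequality).
[cite: BakryGentilLedoux2014, Thm 9.6.1] -/
theorem torus_integral_exp_hopfLaxWindow_le (L : ℕ) [NeZero L] (β' : ℝ) (hβ : |β'| < 1 / 12) (B : Finset (Literature.MathematicalPhysics.QuantumLattice.ZdEdge 3))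
    (hinj : Set.InjOn (Literature.MathematicalPhysics.QuantumLattice.torusEdge (d := 3) L) ↑B) {φ : Literature.MathematicalPhysics.QuantumLattice.LGConfig 3 (Matrix.specialUnitaryGroup (Fin 2) ℂ) → ℝ} {Lf C₀ : ℝ} (hLf : 0 ≤ Lf)
    (hlip : ∀ x y, |φ y - φ x| ≤ Lf * Real.sqrt (∑ et ∈ B, (fundamentalLatticeRep 2).riemannDist (x et) (y et) ^ 2)) (hφ : ∀ y, -C₀ ≤ φ y) :
    ∫ U, Real.exp (⨅ y : Literature.MathematicalPhysics.QuantumLattice.LGConfig 3 (Matrix.specialUnitaryGroup (Fin 2) ℂ), (φ y + (∑ et ∈ B, (fundamentalLatticeRep 2).riemannDist ((Literature.MathematicalPhysics.QuantumLattice.torusLift L U) et) (y et) ^ 2) / (2 * (1 / (1 - 12 * |β'|))))) ∂(wilsonMeasure (d := 3) (L := L) (fundamentalRep (Fin 2)) β') ≤ Real.exp (∫ U, φ (Literature.MathematicalPhysics.QuantumLattice.torusLift L U) ∂(wilsonMeasure (d := 3) (L := L) (fundamentalRep (Fin 2)) β')) := by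
  classical
  haveI := secondCountableTopology_su2
  haveI := borelSpace_config L
  haveI : IsProbabilityMeasure (wilsonMeasure (d := 3) (L := L) (fundamentalRep (Fin 2)) β') :=
    isProbabilityMeasure_wilsonMeasure (d := 3) (L := L) (fundamentalRep (Fin 2)) (continuous_fundamentalRep (Fin 2)) β'
  have h12 : 0 < 1 - 12 * |β'| := by linarith
  have hC : 0 < 2 * (1 / (1 - 12 * |β'|)) := by positivity
  have hφc : Continuous φ := continuous_of_windowLipschitz B hlip
  have hTL : Continuous fun U : GaugeConfig 3 L (Matrix.specialUnitaryGroup (Fin 2) ℂ) => Literature.MathematicalPhysics.QuantumLattice.torusLift L U := continuous_pi fun et => continuous_apply _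
  have hnn : ∀ u v : GaugeConfig 3 L (Matrix.specialUnitaryGroup (Fin 2) ℂ), 0 ≤ torusRiemannDistSq (fundamentalLatticeRep 2) u v := fun u v => by
    unfold torusRiemannDistSq; exact Finset.sum_nonneg fun _ _ => sq_nonneg _
  -- `φ∘torusLift` is `ρ_L`-Lipschitz
  have hlipT : ∀ Q Q' : GaugeConfig 3 L (Matrix.specialUnitaryGroup (Fin 2) ℂ), |φ (Literature.MathematicalPhysics.QuantumLattice.torusLift L Q') - φ (Literature.MathematicalPhysics.QuantumLattice.torusLift L Q)| ≤ Lf * Real.sqrt (torusRiemannDistSq (fundamentalLatticeRep 2) Q Q') :=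
    fun Q Q' => (hlip _ _).trans (mul_le_mul_of_nonneg_left (Real.sqrt_le_sqrt (windowDistSq_torusLift_le B hinj Q Q')) hLf)
  have hmain := wilson_integral_exp_hopfLax_le L β' hβ hLf hlipT
  -- comparison of the Hopf–Lax functions
  have hbddT : ∀ U : GaugeConfig 3 L (Matrix.specialUnitaryGroup (Fin 2) ℂ), BddBelow (Set.range fun v : GaugeConfig 3 L (Matrix.specialUnitaryGroup (Fin 2) ℂ) =>
      φ (Literature.MathematicalPhysics.QuantumLattice.torusLift L v) + torusRiemannDistSq (fundamentalLatticeRep 2) U v / (2 * (1 / (1 - 12 * |β'|)))) := fun U =>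
    ⟨-C₀, by rintro _ ⟨v, rfl⟩; have h0 := div_nonneg (hnn U v) hC.le; show -C₀ ≤ _; linarith [hφ (Literature.MathematicalPhysics.QuantumLattice.torusLift L v)]⟩
  have hcmp : ∀ U : GaugeConfig 3 L (Matrix.specialUnitaryGroup (Fin 2) ℂ), (⨅ y : Literature.MathematicalPhysics.QuantumLattice.LGConfig 3 (Matrix.specialUnitaryGroup (Fin 2) ℂ), (φ y + (∑ et ∈ B, (fundamentalLatticeRep 2).riemannDist ((Literature.MathematicalPhysics.QuantumLattice.torusLift L U) et) (y et) ^ 2) / (2 * (1 / (1 - 12 * |β'|))))) ≤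
      ⨅ v : GaugeConfig 3 L (Matrix.specialUnitaryGroup (Fin 2) ℂ), (φ (Literature.MathematicalPhysics.QuantumLattice.torusLift L v) + torusRiemannDistSq (fundamentalLatticeRep 2) U v / (2 * (1 / (1 - 12 * |β'|)))) := by
    intro U
    refine le_ciInf fun v => (ciInf_le (bddBelow_hopfLaxWindow B hφ hβ _) (Literature.MathematicalPhysics.QuantumLattice.torusLift L v)).trans ?_
    show φ (Literature.MathematicalPhysics.QuantumLattice.torusLift L v) + (∑ et ∈ B, (fundamentalLatticeRep 2).riemannDist (Literature.MathematicalPhysics.QuantumLattice.torusLift L U et) (Literature.MathematicalPhysics.QuantumLattice.torusLift L v et) ^ 2) / (2 * (1 / (1 - 12 * |β'|))) ≤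
      φ (Literature.MathematicalPhysics.QuantumLattice.torusLift L v) + torusRiemannDistSq (fundamentalLatticeRep 2) U v / (2 * (1 / (1 - 12 * |β'|)))
    exact add_le_add le_rfl (div_le_div_of_nonneg_right (windowDistSq_torusLift_le B hinj U v) hC.le)
  -- integrability of the torus Hopf–Lax function (continuity in the `ρ_L` metric structure, g42)
  have hzero : ∀ u v : GaugeConfig 3 L (Matrix.specialUnitaryGroup (Fin 2) ℂ), Real.sqrt (torusRiemannDistSq (fundamentalLatticeRep 2) u v) = 0 ↔ u = v := fun u v => by
    rw [Real.sqrt_eq_zero (hnn u v), torusRiemannDistSq_two_eq_zero_iff]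
  have hself : ∀ u : GaugeConfig 3 L (Matrix.specialUnitaryGroup (Fin 2) ℂ), Real.sqrt (torusRiemannDistSq (fundamentalLatticeRep 2) u u) = 0 := fun u => (hzero u u).2 rfl
  have hcomm : ∀ u v : GaugeConfig 3 L (Matrix.specialUnitaryGroup (Fin 2) ℂ), Real.sqrt (torusRiemannDistSq (fundamentalLatticeRep 2) u v) = Real.sqrt (torusRiemannDistSq (fundamentalLatticeRep 2) v u) :=
    fun u v => by rw [torusRiemannDistSq_two_comm]
  have htri : ∀ u v w : GaugeConfig 3 L (Matrix.specialUnitaryGroup (Fin 2) ℂ), Real.sqrt (torusRiemannDistSq (fundamentalLatticeRep 2) u w) ≤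
      Real.sqrt (torusRiemannDistSq (fundamentalLatticeRep 2) u v) + Real.sqrt (torusRiemannDistSq (fundamentalLatticeRep 2) v w) :=
    fun u v w => sqrt_torusRiemannDistSq_two_triangle u v w
  have hcontQ : Continuous fun U : GaugeConfig 3 L (Matrix.specialUnitaryGroup (Fin 2) ℂ) => ⨅ v : GaugeConfig 3 L (Matrix.specialUnitaryGroup (Fin 2) ℂ), (φ (Literature.MathematicalPhysics.QuantumLattice.torusLift L v) + torusRiemannDistSq (fundamentalLatticeRep 2) U v / (2 * (1 / (1 - 12 * |β'|)))) := by
    letI : MetricSpace (GaugeConfig 3 L (Matrix.specialUnitaryGroup (Fin 2) ℂ)) :=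
      { __ := PseudoMetricSpace.ofDistTopology (fun u v : GaugeConfig 3 L (Matrix.specialUnitaryGroup (Fin 2) ℂ) => Real.sqrt (torusRiemannDistSq (fundamentalLatticeRep 2) u v))
          hself hcomm htri isOpen_iff_riemannDist_ball,
        eq_of_dist_eq_zero := fun {u v} huv => (hzero u v).1 huv }
    have hd2 : ∀ u v : GaugeConfig 3 L (Matrix.specialUnitaryGroup (Fin 2) ℂ), dist u v ^ 2 = torusRiemannDistSq (fundamentalLatticeRep 2) u v := fun u v =>
      Real.sq_sqrt (hnn u v)
    have hlipd : ∀ z w : GaugeConfig 3 L (Matrix.specialUnitaryGroup (Fin 2) ℂ), |φ (Literature.MathematicalPhysics.QuantumLattice.torusLift L z) - φ (Literature.MathematicalPhysics.QuantumLattice.torusLift L w)| ≤ Lf * dist z w := fun z w => by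
      rw [dist_comm]; exact hlipT w z
    have h := hopfLax_continuous (hφc.comp hTL) hLf hlipd (s := (1 / (1 - 12 * |β'|))) (by positivity)
    refine h.congr fun U => ?_
    exact congrArg iInf (funext fun v => by rw [Function.comp_apply, hd2])
  have hiT : Integrable (fun U : GaugeConfig 3 L (Matrix.specialUnitaryGroup (Fin 2) ℂ) => Real.exp (⨅ v : GaugeConfig 3 L (Matrix.specialUnitaryGroup (Fin 2) ℂ), (φ (Literature.MathematicalPhysics.QuantumLattice.torusLift L v) + torusRiemannDistSq (fundamentalLatticeRep 2) U v / (2 * (1 / (1 - 12 * |β'|)))))) (wilsonMeasure (d := 3) (L := L) (fundamentalRep (Fin 2)) β') :=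
    (Real.continuous_exp.comp hcontQ).integrable_of_hasCompactSupport (HasCompactSupport.of_compactSpace _)
  refine le_trans ?_ hmain
  exact integral_mono_of_nonneg (ae_of_all _ fun U => (Real.exp_pos _).le) hiT (ae_of_all _ fun U => Real.exp_le_exp.2 (hcmp U))

/-! ## §4. Passage to the infinite volume -/

/-- ★★★★ **Talagrand's `T₂(1/(1−12|β'|))` in dual form for every infinite-volume limit point, window by window.**  Let `|β'| < 1/12` and let `μ` be any
infinite-volume limit point of the torus Wilson states of three-dimensional `SU(2)` lattice Yang–Mills at coupling `β'`.  For every finite window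
`B ⊆ E⁺(ℤ³)` and every `ρ_B`-Lipschitz `φ` (`ρ_B(x,y)² = Σ_(ẽ∈B) ρ(x_ẽ,y_ẽ)²`):
`∫ exp(inf_y [φ(y) + ρ_B(·,y)²/(2C)]) dμ ≤ exp(∫ φ dμ)`, `C = 1/(1 − 12|β'|)` — the Bobkov–Götze dual form of `W₂^(ρ_B)(ν,μ)² ≤ 2C·KL(ν‖μ)`, with a constant
independent of the window. [cite: BakryGentilLedoux2014, Thm 9.6.1] [cite: ShenZhuZhuCMP2023, Theorem 1.4] -/
theorem limitPoint_integral_exp_hopfLaxWindow_le {β' : ℝ} (hβ : |β'| < 1 / 12) {μ : Measure (Literature.MathematicalPhysics.QuantumLattice.LGConfig 3 (Matrix.specialUnitaryGroup (Fin 2) ℂ))}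
    (hμ : μ ∈ infiniteVolumeLimitPoints (d := 3) (fundamentalRep (Fin 2)) β') (B : Finset (Literature.MathematicalPhysics.QuantumLattice.ZdEdge 3))
    {φ : Literature.MathematicalPhysics.QuantumLattice.LGConfig 3 (Matrix.specialUnitaryGroup (Fin 2) ℂ) → ℝ} {Lf : ℝ} (hLf : 0 ≤ Lf) (hlip : ∀ x y, |φ y - φ x| ≤ Lf * Real.sqrt (∑ et ∈ B, (fundamentalLatticeRep 2).riemannDist (x et) (y et) ^ 2)) :
    ∫ x, Real.exp (⨅ y : Literature.MathematicalPhysics.QuantumLattice.LGConfig 3 (Matrix.specialUnitaryGroup (Fin 2) ℂ), (φ y + (∑ et ∈ B, (fundamentalLatticeRep 2).riemannDist (x et) (y et) ^ 2) / (2 * (1 / (1 - 12 * |β'|))))) ∂μ ≤ Real.exp (∫ x, φ x ∂μ) := by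
  classical
  obtain ⟨Ls, hLs, hprob, hlim⟩ := hμ
  haveI := hprob
  have hφc : Continuous φ := continuous_of_windowLipschitz B hlip
  -- a lower bound for `φ`
  obtain ⟨C₀, hC₀⟩ : ∃ C₀ : ℝ, ∀ y, |φ y| ≤ C₀ := by
    obtain ⟨C, hC⟩ := (isCompact_univ (X := Literature.MathematicalPhysics.QuantumLattice.LGConfig 3 (Matrix.specialUnitaryGroup (Fin 2) ℂ))).exists_bound_of_continuousOn hφc.continuousOn
    exact ⟨C, fun y => by simpa [Real.norm_eq_abs] using hC y (Set.mem_univ _)⟩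
  have hφlb : ∀ y, -C₀ ≤ φ y := fun y => (abs_le.1 (hC₀ y)).1
  -- the two cylinder observables and their torus expectations
  have hQc : Continuous fun x : Literature.MathematicalPhysics.QuantumLattice.LGConfig 3 (Matrix.specialUnitaryGroup (Fin 2) ℂ) => (⨅ y : Literature.MathematicalPhysics.QuantumLattice.LGConfig 3 (Matrix.specialUnitaryGroup (Fin 2) ℂ), (φ y + (∑ et ∈ B, (fundamentalLatticeRep 2).riemannDist (x et) (y et) ^ 2) / (2 * (1 / (1 - 12 * |β'|))))) := continuous_hopfLaxWindow B hφlb hβ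
  have hEc : Continuous fun x : Literature.MathematicalPhysics.QuantumLattice.LGConfig 3 (Matrix.specialUnitaryGroup (Fin 2) ℂ) => Real.exp (⨅ y : Literature.MathematicalPhysics.QuantumLattice.LGConfig 3 (Matrix.specialUnitaryGroup (Fin 2) ℂ), (φ y + (∑ et ∈ B, (fundamentalLatticeRep 2).riemannDist (x et) (y et) ^ 2) / (2 * (1 / (1 - 12 * |β'|))))) := Real.continuous_exp.comp hQc
  have hEcyl : IsCylinder (fun x : Literature.MathematicalPhysics.QuantumLattice.LGConfig 3 (Matrix.specialUnitaryGroup (Fin 2) ℂ) => Real.exp (⨅ y : Literature.MathematicalPhysics.QuantumLattice.LGConfig 3 (Matrix.specialUnitaryGroup (Fin 2) ℂ), (φ y + (∑ et ∈ B, (fundamentalLatticeRep 2).riemannDist (x et) (y et) ^ 2) / (2 * (1 / (1 - 12 * |β'|)))))) B := by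
    intro x x' hxx'
    exact congrArg Real.exp (isCylinder_hopfLaxWindow B φ β' hxx')
  have hEbd : ∃ C, ∀ x : Literature.MathematicalPhysics.QuantumLattice.LGConfig 3 (Matrix.specialUnitaryGroup (Fin 2) ℂ), |Real.exp (⨅ y : Literature.MathematicalPhysics.QuantumLattice.LGConfig 3 (Matrix.specialUnitaryGroup (Fin 2) ℂ), (φ y + (∑ et ∈ B, (fundamentalLatticeRep 2).riemannDist (x et) (y et) ^ 2) / (2 * (1 / (1 - 12 * |β'|)))))| ≤ C :=
    ⟨Real.exp C₀, fun x => by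
      rw [abs_of_pos (Real.exp_pos _)]
      exact Real.exp_le_exp.2 ((hopfLaxWindow_le_self B hφlb hβ x).trans (le_abs_self _ |>.trans (hC₀ x)))⟩
  have hφcyl : IsCylinder φ B := isCylinder_of_windowLipschitz B hlip
  have hlimE := hlim _ B hEcyl hEc hEbd
  have hlimφ := hlim _ B hφcyl hφc ⟨C₀, hC₀⟩
  -- eventually (in `k`) the torus inequality holds
  have hev : ∀ᶠ k : ℕ in atTop, Set.InjOn (Literature.MathematicalPhysics.QuantumLattice.torusEdge (d := 3) (Ls k + 1)) ↑B := by
    have ht : Tendsto (fun k : ℕ => Ls k + 1) atTop atTop := (hLs.add_const 1).tendsto_atTop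
    exact ht.eventually (eventually_injOn_torusEdge B)
  have hineq : ∀ᶠ k : ℕ in atTop,
      wilsonExpectation (L := Ls k + 1) (fundamentalRep (Fin 2)) β' (toTorusObservable (Ls k + 1) (fun x : Literature.MathematicalPhysics.QuantumLattice.LGConfig 3 (Matrix.specialUnitaryGroup (Fin 2) ℂ) => Real.exp (⨅ y : Literature.MathematicalPhysics.QuantumLattice.LGConfig 3 (Matrix.specialUnitaryGroup (Fin 2) ℂ), (φ y + (∑ et ∈ B, (fundamentalLatticeRep 2).riemannDist (x et) (y et) ^ 2) / (2 * (1 / (1 - 12 * |β'|))))))) ≤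
        Real.exp (wilsonExpectation (L := Ls k + 1) (fundamentalRep (Fin 2)) β' (toTorusObservable (Ls k + 1) φ)) := by
    filter_upwards [hev] with k hk
    exact torus_integral_exp_hopfLaxWindow_le (Ls k + 1) β' hβ B hk hLf hlip hφlb
  have hlimE' : Tendsto (fun k : ℕ => Real.exp (wilsonExpectation (L := Ls k + 1) (fundamentalRep (Fin 2)) β' (toTorusObservable (Ls k + 1) φ)))
      atTop (𝓝 (Real.exp (∫ x, φ x ∂μ))) := (Real.continuous_exp.tendsto _).comp hlimφ
  exact le_of_tendsto_of_tendsto hlimE hlimE' hineq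

end Summit.QuantumFields.YangMills.Theorems.ColdStartUniversality
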